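import Summits.ABC.ABC.Theses.DefiniteXi
import Summits.ABC.ABC.Theorems.DefiniteXiSteinbergCoreSplit
import Summits.ABC.ABC.Theorems.DefiniteXiSteinbergCoreThesisCalibration
import Summits.ABC.ABC.Theorems.DefiniteXiSteinbergCoreXiDegreeComparisonPrime
import Summits.ABC.ABC.Theorems.DefiniteXiXiStrongBoundItemsCalibration
import HarnessLib

/-!
# Crux `SteinbergCore` (stmt-ABC-15024), line `p6_tamagawa_split` — the PRIME RUNG of the crux:
# the deciding chain of route DefiniteXi runs on the prime rungs of its two binders, and the prime
# rung of `SteinbergCore` is thesis-strength modulo ONE named fact and route items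

The deciding theorem `DefiniteXi.closes` consumes its two binders `A = EisensteinQuarantine`
(stmt-ABC-15023) and `B = SteinbergCore` (stmt-ABC-15024) only through `XiStrongBound`, and `XiStrongBound`
only through `DefiniteGlue`, which instantiates it at `N⁻ = q` ONE ODD PRIME of the conductor.  The
`∀`-admissible-`N⁻` generality of `A` and `B` (composite `N⁻`, the corner `N/N⁻ = 2^k`) is therefore idle
in the route, yet it is what makes child 1 of the split of `B` (`stub_xiDegreeComparison`) depend on
Takahashi 2001 Thm. 2.3 for SHIMURA curves (`hTlev`/`hT2` of `xiDegreeComparison_of_facts`, p139336, and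
of `steinbergCore_iff_freyDegreeBound_of_takahashi`, p160000) — XL formal debt that no deciding step
uses (strategy census v3 §Recommendation 3; leads c1/c2 "DECISION FOR THE PLANNER").

This file is the kernel certificate for the PRIME-TYPE RECUT of the two binders.  Writing
`A♭` / `B♭` for `A` / `B` with `∀ Nm, Odd Nm → Squarefree Nm → Odd ω(Nm) → Nm ∣ N →` replaced by
`∀ q, q.Prime → q ≠ 2 → q ∣ N →` (inline hypotheses below — no new definition, no item restated as a
fact), it proves:

* `steinbergCore_imp_primeRung`, `eisensteinQuarantine_imp_primeRung` — `B → B♭`, `A → A♭` (the recut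
  items are instances of the filed ones);
* `primeXiStrongBound_of_primeRungs` — `A♭ → B♭ →` the prime rung of `XiStrongBound` (verbatim the
  hypothesis `hXSq` of (E₁) `DefiniteXiXiBoundUpgrade.minimalDegreeBound_of_primeXiStrongBound`): the
  35-line algebra of `closes` at `Nm = q` (`ξ = sixPart ξ · cps ξ`, `∏_{p ∣ N} v_p = (∏_{p ∣ N, p ≠ q} v_p) · v_q`);
* `minimalDegreeBound_of_primeRungs`, `freyDegreeBound_of_primeRungs`, `abc_of_primeRungs` — THE RECUT
  DECIDING CHAIN `A♭ → B♭ → DefiniteRTControlPrime → FreyModularity → MinimalBoundGivesTarget →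
  PeterssonLowerBound → DegreeBoundToABCOfPetersson → ABC`, through (E₁) instead of `DefiniteGlue`
  (so the recut `closes` needs one binder FEWER);
* `primeRung_of_subs_frey` — the prime-type twin of the split glue `steinbergCore_of_subs_frey`
  (p137293): (comparison at prime type) → (P6 = `stub_primeToSixDegreeBound`) → (Frey allowance) → `B♭`;
* `primeRung_of_freyDegreeBound_of_items` — **`FreyDegreeBound → B♭` modulo ONE named
  fact**, Takahashi 2001 Thm. 2.3 at `q ∥ N` (`takahashi2001_thm_2_3_of_coprime`), plus the r9 route items
  `MazurKenkuBound` (= `PastenShimura2024_minimalDegree_le_163_mul`), `IsogenyValuationTransport`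
  (= `PastenShimura2024_lemma_6_8`) and `FreyModularity`: child 1 at prime type (p137891), P6 from the
  thesis, the allowance from the weak rung (`allTamExp_of_polyFreyDegree`, p160000);
* `primeRung_iff_freyDegreeBound_of_items` — **the calibration of the recut crux**: modulo that one fact,
  those three items, `A♭` and `DefiniteRTControlPrime` (itself `⟸` the same fact + items,
  `definiteRTControlPrime_of_items`), `B♭ ⟺ FreyDegreeBound`.

Reading (numbers, not adjectives): after the recut, child 1 of the split of `B♭` is CLOSED MODULO
{`takahashi2001_thm_2_3_of_coprime`, stmt-ABC-15125, stmt-ABC-18928, stmt-ABC-11340} by p137891 (constant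
`4·163²`), child 3 is closed modulo stmt-ABC-2026 by p160000, and the atom P6 is unchanged (abc-strength:
`P6 ≡ FreyDegreeBound ≡ abc|Frey` modulo the route's own binders, p160000 / `AtomModuloBets`).  Nothing here
touches the atom; exponent `2` and `0 < ε` are kept everywhere (Masser 1990; Disproof §D).

## References

* [Takahashi2001] S. Takahashi, Degrees of parametrizations of elliptic curves by Shimura curves,
  J. Number Theory 90 (2001) 74–88 — Thm. 2.3 (p. 79), remark p. 80.
* [PastenShimura2024] H. Pasten, Shimura curves and the abc conjecture, J. Number Theory 254 (2024)
  = arXiv:1705.09251 — §3 p. 13 (Mazur–Kenku degree transport), Lemma 6.8 (p. 22).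
* [Masser1990] D. W. Masser, Note on a conjecture of Szpiro, Astérisque 183 (1990) — exponent 2 sharp.
-/

-- `Summit.<Summit>.<Problem>` is the mandated summit-side namespace (CONVENTIONS §2); for the single-conjunct
-- summit `ABC` the two coincide, so the duplicate `ABC.ABC` is deliberate.
set_option linter.dupNamespace false

noncomputable section

namespace Summit.ABC.ABC.Theorems.SteinbergCorePrimeRung

open Literature.NumberTheory.EllipticCurves Literature.NumberTheory.EllipticCurves.ModularForms
open Literature.NumberTheory.Automorphic
open Summit.ABC.ABC.Theses.DefiniteXi
open Summit.ABC.ABC.Theorems.DefiniteXiXiStrongBoundItemsCalibration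
  (mazurKenkuBound_iff isogenyValuationTransport_iff definiteRTControlPrime_of_items)

/-! ## (1) The recut binders are instances of the filed ones -/

/-- **`B → B♭`**: the crux `SteinbergCore` specialises to its prime rung (`Nm := q`: `Odd q`, `Squarefree q`,
`q.primeFactors = {q}` of odd cardinality `1`). [folklore] -/
theorem steinbergCore_imp_primeRung (h : SteinbergCore) :
    ∀ ε : ℝ, 0 < ε → ∃ C : ℝ, ∀ a b : ℤ, IsCoprime a b → a * b * (a + b) ≠ 0 → ∀ (N : ℕ) [NeZero N],
      (freyCurve a b).conductorNorm ℤ = N → ∀ q : ℕ, q.Prime → q ≠ 2 → q ∣ N →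
      ((brandtXi (N / q) q (fun n => (freyCurve a b).LFunction n) /
          (ordProj[2] (brandtXi (N / q) q (fun n => (freyCurve a b).LFunction n)) *
            ordProj[3] (brandtXi (N / q) q (fun n => (freyCurve a b).LFunction n))) : ℕ) : ℝ) *
        ((∏ p ∈ N.primeFactors, ((freyCurve a b).minimalDiscriminantNorm ℤ).factorization p : ℕ) : ℝ) ≤
        C * (N : ℝ) ^ (2 + ε) := by
  intro ε hε
  obtain ⟨C, hC⟩ := h ε hε
  refine ⟨C, fun a b hab h0 N _ hN q hq hq2 hqN => ?_⟩
  have hcard : Odd q.primeFactors.card := by rw [hq.primeFactors]; simp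
  exact hC a b hab h0 N hN q (hq.odd_of_ne_two hq2) (Irreducible.squarefree hq) hcard hqN

/-- **`A → A♭`**: the binder `EisensteinQuarantine` specialises to its prime rung; at `Nm = q` the allowance
`∏_{p ∣ N, p ∤ Nm} v_p` is `∏_{p ∈ N.primeFactors \ {q}} v_p`. [folklore] -/
theorem eisensteinQuarantine_imp_primeRung (h : EisensteinQuarantine) :
    ∀ ε : ℝ, 0 < ε → ∃ C : ℝ, ∀ a b : ℤ, IsCoprime a b → a * b * (a + b) ≠ 0 → ∀ (N : ℕ) [NeZero N],
      (freyCurve a b).conductorNorm ℤ = N → ∀ q : ℕ, q.Prime → q ≠ 2 → q ∣ N →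
      ((ordProj[2] (brandtXi (N / q) q (fun n => (freyCurve a b).LFunction n)) *
          ordProj[3] (brandtXi (N / q) q (fun n => (freyCurve a b).LFunction n)) : ℕ) : ℝ) ≤
        C * (N : ℝ) ^ ε *
          ((∏ p ∈ N.primeFactors \ {q}, ((freyCurve a b).minimalDiscriminantNorm ℤ).factorization p : ℕ) : ℝ) := by
  intro ε hε
  obtain ⟨C, hC⟩ := h ε hε
  refine ⟨C, fun a b hab h0 N _ hN q hq hq2 hqN => ?_⟩
  have hcard : Odd q.primeFactors.card := by rw [hq.primeFactors]; simp
  have h1 := hC a b hab h0 N hN q (hq.odd_of_ne_two hq2) (Irreducible.squarefree hq) hcard hqN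
  rwa [hq.primeFactors] at h1

/-! ## (2) The algebra of `closes` at `Nm = q`: `A♭ ∧ B♭ ⟹` the prime rung of `XiStrongBound` -/

section PrimeRungs

variable
  /- `A♭`: the prime rung of `EisensteinQuarantine` (stmt-ABC-15023), as a hypothesis. -/
  (hA : ∀ ε : ℝ, 0 < ε → ∃ C : ℝ, ∀ a b : ℤ, IsCoprime a b → a * b * (a + b) ≠ 0 → ∀ (N : ℕ) [NeZero N],
      (freyCurve a b).conductorNorm ℤ = N → ∀ q : ℕ, q.Prime → q ≠ 2 → q ∣ N →
      ((ordProj[2] (brandtXi (N / q) q (fun n => (freyCurve a b).LFunction n)) *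
          ordProj[3] (brandtXi (N / q) q (fun n => (freyCurve a b).LFunction n)) : ℕ) : ℝ) ≤
        C * (N : ℝ) ^ ε *
          ((∏ p ∈ N.primeFactors \ {q}, ((freyCurve a b).minimalDiscriminantNorm ℤ).factorization p : ℕ) : ℝ))
  /- `B♭`: the prime rung of `SteinbergCore` (stmt-ABC-15024), as a hypothesis. -/
  (hB : ∀ ε : ℝ, 0 < ε → ∃ C : ℝ, ∀ a b : ℤ, IsCoprime a b → a * b * (a + b) ≠ 0 → ∀ (N : ℕ) [NeZero N],
      (freyCurve a b).conductorNorm ℤ = N → ∀ q : ℕ, q.Prime → q ≠ 2 → q ∣ N →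
      ((brandtXi (N / q) q (fun n => (freyCurve a b).LFunction n) /
          (ordProj[2] (brandtXi (N / q) q (fun n => (freyCurve a b).LFunction n)) *
            ordProj[3] (brandtXi (N / q) q (fun n => (freyCurve a b).LFunction n))) : ℕ) : ℝ) *
        ((∏ p ∈ N.primeFactors, ((freyCurve a b).minimalDiscriminantNorm ℤ).factorization p : ℕ) : ℝ) ≤
        C * (N : ℝ) ^ (2 + ε))

include hA hB

/-- **`A♭ → B♭ → XiStrongBound♭`.**  For an odd prime `q ∣ N`: `ξ = sixPart ξ · cps ξ` (`sixPart ξ ∣ ξ`) and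
`∏_{p ∣ N} v_p = (∏_{p ∣ N, p ≠ q} v_p) · v_q`, so
`ξ · v_q = sixPart ξ · (cps ξ · v_q) ≤ C₁ N^{ε/2} (∏_{p ≠ q} v_p) · cps ξ · v_q = C₁ N^{ε/2} · cps ξ · T ≤ C₁ C₂ N^{2+ε}`.
The conclusion is verbatim the hypothesis `hXSq` of (E₁)
`DefiniteXiXiBoundUpgrade.minimalDegreeBound_of_primeXiStrongBound`. [folklore] -/
theorem primeXiStrongBound_of_primeRungs :
    ∀ ε : ℝ, 0 < ε → ∃ C : ℝ, ∀ a b : ℤ, IsCoprime a b → a * b * (a + b) ≠ 0 →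
      ∀ (N : ℕ) [NeZero N], (freyCurve a b).conductorNorm ℤ = N → ∀ q : ℕ, q.Prime → q ≠ 2 → q ∣ N →
        (brandtXi (N / q) q (fun n => (freyCurve a b).LFunction n) : ℝ) *
          ((((freyCurve a b).minimalDiscriminantNorm ℤ).factorization q : ℕ) : ℝ) ≤
            C * (N : ℝ) ^ (2 + ε) := by
  intro ε hε
  obtain ⟨C₁, hC₁⟩ := hA (ε / 2) (by linarith)
  obtain ⟨C₂, hC₂⟩ := hB (ε / 2) (by linarith)
  refine ⟨max C₁ 0 * max C₂ 0, ?_⟩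
  intro a b hab h0 N _ hN q hq hq2 hqN
  have hA' := hC₁ a b hab h0 N hN q hq hq2 hqN
  have hB' := hC₂ a b hab h0 N hN q hq hq2 hqN
  set ξ : ℕ := brandtXi (N / q) q (fun n => (freyCurve a b).LFunction n) with hξ
  set s : ℕ := ordProj[2] ξ * ordProj[3] ξ with hs
  set v : ℕ → ℕ := fun p => ((freyCurve a b).minimalDiscriminantNorm ℤ).factorization p with hv
  have hNpos : (0 : ℝ) < (N : ℝ) := by exact_mod_cast Nat.pos_of_ne_zero (NeZero.ne N)
  have hqmem : q ∈ N.primeFactors := Nat.mem_primeFactors.mpr ⟨hq, hqN, NeZero.ne N⟩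
  -- `sixPart ξ ∣ ξ`, hence `ξ = s * (ξ / s)`
  have hsdvd : s ∣ ξ := by
    rcases Nat.eq_zero_or_pos ξ with h0ξ | _
    · rw [h0ξ]; exact dvd_zero _
    · exact Nat.Coprime.mul_dvd_of_dvd_of_dvd
        (Nat.Coprime.pow _ _ (by norm_num : Nat.Coprime 2 3)) (Nat.ordProj_dvd ξ 2) (Nat.ordProj_dvd ξ 3)
  have hsc : (ξ : ℝ) = (s : ℝ) * ((ξ / s : ℕ) : ℝ) := by
    have : s * (ξ / s) = ξ := Nat.mul_div_cancel' hsdvd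
    exact_mod_cast this.symm
  -- `∏_{p ∣ N} v_p = (∏_{p ∣ N, p ≠ q} v_p) * v_q`
  have hprodN : (∏ p ∈ N.primeFactors \ {q}, v p) * v q = ∏ p ∈ N.primeFactors, v p := by
    rw [← Finset.prod_sdiff (Finset.singleton_subset_iff.mpr hqmem), Finset.prod_singleton]
  have hprod : ((∏ p ∈ N.primeFactors \ {q}, v p : ℕ) : ℝ) * ((v q : ℕ) : ℝ) =
      ((∏ p ∈ N.primeFactors, v p : ℕ) : ℝ) := by
    exact_mod_cast hprodN
  have hL : (0 : ℝ) ≤ ((∏ p ∈ N.primeFactors \ {q}, v p : ℕ) : ℝ) := by positivity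
  have hc : (0 : ℝ) ≤ ((ξ / s : ℕ) : ℝ) * ((v q : ℕ) : ℝ) := by positivity
  have hrpow1 : (0 : ℝ) ≤ (N : ℝ) ^ (ε / 2) := Real.rpow_nonneg hNpos.le _
  have hC₁0 : (0 : ℝ) ≤ max C₁ 0 := le_max_right _ _
  have hA'' : (s : ℝ) ≤ max C₁ 0 * (N : ℝ) ^ (ε / 2) * ((∏ p ∈ N.primeFactors \ {q}, v p : ℕ) : ℝ) := by
    refine le_trans hA' ?_
    gcongr
    exact le_max_left _ _
  have hB'' : ((ξ / s : ℕ) : ℝ) * ((∏ p ∈ N.primeFactors, v p : ℕ) : ℝ) ≤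
      max C₂ 0 * (N : ℝ) ^ (2 + ε / 2) := by
    refine le_trans hB' ?_
    gcongr
    exact le_max_left _ _
  have hNsplit : (N : ℝ) ^ (ε / 2) * (N : ℝ) ^ (2 + ε / 2) = (N : ℝ) ^ (2 + ε) := by
    rw [← Real.rpow_add hNpos]; ring_nf
  calc (ξ : ℝ) * ((v q : ℕ) : ℝ)
      = (s : ℝ) * (((ξ / s : ℕ) : ℝ) * ((v q : ℕ) : ℝ)) := by rw [hsc]; ring
    _ ≤ (max C₁ 0 * (N : ℝ) ^ (ε / 2) * ((∏ p ∈ N.primeFactors \ {q}, v p : ℕ) : ℝ)) *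
          (((ξ / s : ℕ) : ℝ) * ((v q : ℕ) : ℝ)) := by
        gcongr
    _ = max C₁ 0 * (N : ℝ) ^ (ε / 2) *
          (((ξ / s : ℕ) : ℝ) * (((∏ p ∈ N.primeFactors \ {q}, v p : ℕ) : ℝ) * ((v q : ℕ) : ℝ))) := by ring
    _ = max C₁ 0 * (N : ℝ) ^ (ε / 2) * (((ξ / s : ℕ) : ℝ) * ((∏ p ∈ N.primeFactors, v p : ℕ) : ℝ)) := by
        rw [hprod]
    _ ≤ max C₁ 0 * (N : ℝ) ^ (ε / 2) * (max C₂ 0 * (N : ℝ) ^ (2 + ε / 2)) := by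
        gcongr
    _ = max C₁ 0 * max C₂ 0 * (N : ℝ) ^ (2 + ε) := by rw [← hNsplit]; ring

/-! ## (3) The recut deciding chain -/

/-- **The degree bound for minimal data from the two prime rungs and `DefiniteRTControlPrime`** —
`primeXiStrongBound_of_primeRungs` fed into (E₁)
`DefiniteXiXiBoundUpgrade.minimalDegreeBound_of_primeXiStrongBound` (which absorbs the finitely many Frey
curves of `2`-power conductor; no `DefiniteGlue` binder needed). [folklore] -/
theorem minimalDegreeBound_of_primeRungs (hRT : DefiniteRTControlPrime) :
    ∀ ε : ℝ, 0 < ε → ∃ C : ℝ, ∀ a b : ℤ, IsCoprime a b → a * b * (a + b) ≠ 0 →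
      ∀ (N : ℕ) [NeZero N], (freyCurve a b).conductorNorm ℤ = N →
      ∀ D : ModularParametrizationData (freyCurve a b) N,
        (∀ D' : ModularParametrizationData (freyCurve a b) N, D.deg ≤ D'.deg) →
          (D.deg : ℝ) ≤ C * (N : ℝ) ^ (2 + ε) :=
  DefiniteXiXiBoundUpgrade.minimalDegreeBound_of_primeXiStrongBound (primeXiStrongBound_of_primeRungs hA hB) hRT

/-- **The thesis from the two prime rungs**: `A♭ → B♭ → DefiniteRTControlPrime → FreyModularity → FreyDegreeBound`
(`freyDegreeBound_of_primeXiStrongBound`: (E₁) and the proved glue `minimalBoundGivesTarget_proof`). [folklore] -/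
theorem freyDegreeBound_of_primeRungs (hRT : DefiniteRTControlPrime) (hMod : FreyModularity) :
    FreyDegreeBound :=
  DefiniteXiXiStrongBoundPrimeCalibration.freyDegreeBound_of_primeXiStrongBound
    (primeXiStrongBound_of_primeRungs hA hB) hRT hMod

end PrimeRungs

/-- **THE RECUT DECIDING CHAIN.**  `A♭ → B♭ → DefiniteRTControlPrime → FreyModularity → MinimalBoundGivesTarget →
PeterssonLowerBound → DegreeBoundToABCOfPetersson → ABC`: the deciding theorem `DefiniteXi.closes` with both
binders cut to prime type and `DefiniteGlue` no longer a binder (its prime-rung content is the proved (E₁)).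
A planner recutting stmt-ABC-15023 / stmt-ABC-15024 to prime type can take this term as the new `closes` body.
[folklore] -/
theorem abc_of_primeRungs : (∀ ε : ℝ, 0 < ε → ∃ C : ℝ, ∀ a b : ℤ, IsCoprime a b → a * b * (a + b) ≠ 0 → ∀ (N : ℕ) [NeZero N], (Literature.NumberTheory.EllipticCurves.freyCurve a b).conductorNorm ℤ = N → ∀ q : ℕ, q.Prime → q ≠ 2 → q ∣ N → ((ordProj[2] (Literature.NumberTheory.Automorphic.brandtXi (N / q) q (fun n => (Literature.NumberTheory.EllipticCurves.freyCurve a b).LFunction n)) * ordProj[3] (Literature.NumberTheory.Automorphic.brandtXi (N / q) q (fun n => (Literature.NumberTheory.EllipticCurves.freyCurve a b).LFunction n)) : ℕ) : ℝ) ≤ C * (N : ℝ) ^ ε * ((∏ p ∈ N.primeFactors \ {q}, ((Literature.NumberTheory.EllipticCurves.freyCurve a b).minimalDiscriminantNorm ℤ).factorization p : ℕ) : ℝ)) → (∀ ε : ℝ, 0 < ε → ∃ C : ℝ, ∀ a b : ℤ, IsCoprime a b → a * b * (a + b) ≠ 0 → ∀ (N : ℕ) [NeZero N], (Literature.NumberTheory.EllipticCurves.freyCurve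 a b).conductorNorm ℤ = N → ∀ q : ℕ, q.Prime → q ≠ 2 → q ∣ N → ((Literature.NumberTheory.Automorphic.brandtXi (N / q) q (fun n => (Literature.NumberTheory.EllipticCurves.freyCurve a b).LFunction n) / (ordProj[2] (Literature.NumberTheory.Automorphic.brandtXi (N / q) q (fun n => (Literature.NumberTheory.EllipticCurves.freyCurve a b).LFunction n)) * ordProj[3] (Literature.NumberTheory.Automorphic.brandtXi (N / q) q (fun n => (Literature.NumberTheory.EllipticCurves.freyCurve a b).LFunction n))) : ℕ) : ℝ) * ((∏ p ∈ N.primeFactors, ((Literature.NumberTheory.EllipticCurves.freyCurve a b).minimalDiscriminantNorm ℤ).factorization p : ℕ) : ℝ) ≤ C * (N : ℝ) ^ (2 + ε)) → Summit.ABC.ABC.Theses.DefiniteXi.DefiniteRTControlPrime → Summit.ABC.ABC.Theses.DefiniteXi.FreyModularity → Summit.ABC.ABC.Theses.DefiniteXi.MinimalBoundGivesTarget → Summit.ABC.ABC.Theses.DefiniteXi.PeterssonLowerBound → Summit.ABC.ABC.Theses.DefiniteXi.DegreeBoundToABCOfPetersson → _root_.ABC :=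
  fun hA hB hRT hMod hMin hP hDeg => hDeg hP (hMin hMod (minimalDegreeBound_of_primeRungs hA hB hRT))

/-! ## (4) The prime rung of `B` from below: split glue at prime type, and `FreyDegreeBound ⟹ B♭` -/

/-- **The route target gives the atom P6** (`stub_primeToSixDegreeBound` of the skeleton): a minimal datum has
degree at most that of the datum `FreyDegreeBound` provides, and `cps n ≤ n`
(`primeToSixDegreeBound_of_minimalDegreeBound`, p137293).  (Tree copy of the strategist's workfile lemma
`Cruxes/SteinbergCore/AtomModuloBets.primeToSix_of_freyDegreeBound`.) [folklore] -/
theorem primeToSixDegreeBound_of_freyDegreeBound (hX : FreyDegreeBound) :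
    ∀ ε : ℝ, 0 < ε → ∃ C : ℝ, ∀ a b : ℤ, IsCoprime a b → a * b * (a + b) ≠ 0 → ∀ (N : ℕ) [NeZero N],
      (Literature.NumberTheory.EllipticCurves.freyCurve a b).conductorNorm ℤ = N →
      ∀ D : Literature.NumberTheory.EllipticCurves.ModularForms.ModularParametrizationData
        (Literature.NumberTheory.EllipticCurves.freyCurve a b) N,
        (∀ D' : Literature.NumberTheory.EllipticCurves.ModularForms.ModularParametrizationData
          (Literature.NumberTheory.EllipticCurves.freyCurve a b) N, D.deg ≤ D'.deg) →
        ((D.deg / (ordProj[2] D.deg * ordProj[3] D.deg) : ℕ) : ℝ) ≤ C * (N : ℝ) ^ (2 + ε) := by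
  refine Summit.ABC.ABC.Theorems.primeToSixDegreeBound_of_minimalDegreeBound ?_
  intro ε hε
  obtain ⟨C, hC⟩ := hX ε hε
  refine ⟨C, ?_⟩
  intro a b hab h0 N _ hN D hDmin
  obtain ⟨D₀, hD₀⟩ := hC a b hab h0 N hN
  have h1 : (D.deg : ℝ) ≤ (D₀.deg : ℝ) := by exact_mod_cast hDmin D₀
  exact h1.trans hD₀

/-- **Split glue at prime type** (the prime-rung twin of `steinbergCore_of_subs_frey`, p137293).  Hypotheses:
(1) the definite comparison away from `6` at prime type, `ξ(N/q,q) ≠ 0 → ∃ D minimal, cps ξ ≤ C_ε N^ε · cps(deg D) · T³`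
(known in print; landed modulo facts as `xiDegreeComparison_prime_of_facts`, p137891); (2) P6, the prime-to-`6` part
of the minimal modular degree of `E_(a,b)` is `≤ C_ε N^(2+ε)` (the abc-strength atom); (3) the Frey allowance
`T(E_(a,b)) ≤ C_ε N^ε`.  Conclusion: `B♭`.  Proof: at `ξ = 0` the left side is `0`; otherwise
`cps ξ · T ≤ C₀ N^{ε/4} cps(deg D) T³ · T ≤ C₀ N^{ε/4} · C₁ N^{2+ε/4} · (C₂ N^{ε/8})⁴`. [folklore] -/
theorem primeRung_of_subs_frey
    (hC : ∀ ε : ℝ, 0 < ε → ∃ C : ℝ, ∀ a b : ℤ, IsCoprime a b → a * b * (a + b) ≠ 0 → ∀ (N : ℕ) [NeZero N],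
      (freyCurve a b).conductorNorm ℤ = N → ∀ q : ℕ, q.Prime → q ≠ 2 → q ∣ N →
      brandtXi (N / q) q (fun n => (freyCurve a b).LFunction n) ≠ 0 →
      ∃ D : ModularParametrizationData (freyCurve a b) N,
        (∀ D' : ModularParametrizationData (freyCurve a b) N, D.deg ≤ D'.deg) ∧
        ((brandtXi (N / q) q (fun n => (freyCurve a b).LFunction n) /
            (ordProj[2] (brandtXi (N / q) q (fun n => (freyCurve a b).LFunction n)) *
              ordProj[3] (brandtXi (N / q) q (fun n => (freyCurve a b).LFunction n))) : ℕ) : ℝ) ≤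
          C * (N : ℝ) ^ ε * ((D.deg / (ordProj[2] D.deg * ordProj[3] D.deg) : ℕ) : ℝ) *
            ((∏ p ∈ N.primeFactors, ((freyCurve a b).minimalDiscriminantNorm ℤ).factorization p : ℕ) : ℝ) ^ 3)
    (hP : ∀ ε : ℝ, 0 < ε → ∃ C : ℝ, ∀ a b : ℤ, IsCoprime a b → a * b * (a + b) ≠ 0 → ∀ (N : ℕ) [NeZero N],
      (freyCurve a b).conductorNorm ℤ = N →
      ∀ D : ModularParametrizationData (freyCurve a b) N,
        (∀ D' : ModularParametrizationData (freyCurve a b) N, D.deg ≤ D'.deg) →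
        ((D.deg / (ordProj[2] D.deg * ordProj[3] D.deg) : ℕ) : ℝ) ≤ C * (N : ℝ) ^ (2 + ε))
    (hT : ∀ ε : ℝ, 0 < ε → ∃ C : ℝ, ∀ a b : ℤ, IsCoprime a b → a * b * (a + b) ≠ 0 → ∀ (N : ℕ) [NeZero N],
      (freyCurve a b).conductorNorm ℤ = N →
      ((∏ p ∈ N.primeFactors, ((freyCurve a b).minimalDiscriminantNorm ℤ).factorization p : ℕ) : ℝ) ≤
        C * (N : ℝ) ^ ε) :
    ∀ ε : ℝ, 0 < ε → ∃ C : ℝ, ∀ a b : ℤ, IsCoprime a b → a * b * (a + b) ≠ 0 → ∀ (N : ℕ) [NeZero N],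
      (freyCurve a b).conductorNorm ℤ = N → ∀ q : ℕ, q.Prime → q ≠ 2 → q ∣ N →
      ((brandtXi (N / q) q (fun n => (freyCurve a b).LFunction n) /
          (ordProj[2] (brandtXi (N / q) q (fun n => (freyCurve a b).LFunction n)) *
            ordProj[3] (brandtXi (N / q) q (fun n => (freyCurve a b).LFunction n))) : ℕ) : ℝ) *
        ((∏ p ∈ N.primeFactors, ((freyCurve a b).minimalDiscriminantNorm ℤ).factorization p : ℕ) : ℝ) ≤
        C * (N : ℝ) ^ (2 + ε) := by
  intro ε hε
  obtain ⟨C₀, hC₀⟩ := hC (ε / 4) (by linarith)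
  obtain ⟨C₁, hC₁⟩ := hP (ε / 4) (by linarith)
  obtain ⟨C₂, hC₂⟩ := hT (ε / 8) (by linarith)
  refine ⟨max C₀ 0 * max C₁ 0 * max C₂ 0 ^ 4, ?_⟩
  intro a b hab h0 N _ hN q hq hq2 hqN
  have hNpos : (0 : ℝ) < (N : ℝ) := by exact_mod_cast Nat.pos_of_ne_zero (NeZero.ne N)
  set ξ : ℕ := brandtXi (N / q) q (fun n => (freyCurve a b).LFunction n) with hξ
  set T : ℕ := ∏ p ∈ N.primeFactors, ((freyCurve a b).minimalDiscriminantNorm ℤ).factorization p with hTdef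
  -- exponent bookkeeping: `N^(ε/4) · N^(2 + ε/4) · (N^(ε/8))⁴ = N^(2+ε)`
  have hfour : ((N : ℝ) ^ (ε / 8)) ^ (4 : ℕ) = (N : ℝ) ^ (ε / 2) := by
    rw [← Real.rpow_natCast ((N : ℝ) ^ (ε / 8)) 4, ← Real.rpow_mul hNpos.le]
    congr 1
    push_cast
    ring
  have hsplit : (N : ℝ) ^ (ε / 4) * (N : ℝ) ^ (2 + ε / 4) * ((N : ℝ) ^ (ε / 8)) ^ (4 : ℕ) =
      (N : ℝ) ^ (2 + ε) := by
    rw [hfour, ← Real.rpow_add hNpos, ← Real.rpow_add hNpos]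
    ring_nf
  have hRHS0 : (0 : ℝ) ≤ max C₀ 0 * max C₁ 0 * max C₂ 0 ^ 4 * (N : ℝ) ^ (2 + ε) := by positivity
  have hT0 : (0 : ℝ) ≤ (T : ℝ) := by positivity
  have hTle : (T : ℝ) ≤ max C₂ 0 * (N : ℝ) ^ (ε / 8) := by
    refine (hC₂ a b hab h0 N hN).trans ?_
    exact mul_le_mul_of_nonneg_right (le_max_left _ _) (by positivity)
  by_cases hξ0 : ξ = 0
  · -- junk branch: no eigen-line (`ξ = 0`), the left side vanishes
    have : ξ / (ordProj[2] ξ * ordProj[3] ξ) = 0 := by rw [hξ0, Nat.zero_div]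
    rw [this]
    simpa using hRHS0
  · obtain ⟨D, hDmin, hcmp⟩ := hC₀ a b hab h0 N hN q hq hq2 hqN hξ0
    have hP' : ((D.deg / (ordProj[2] D.deg * ordProj[3] D.deg) : ℕ) : ℝ) ≤
        max C₁ 0 * (N : ℝ) ^ (2 + ε / 4) :=
      (hC₁ a b hab h0 N hN D hDmin).trans
        (mul_le_mul_of_nonneg_right (le_max_left _ _) (by positivity))
    have hcmp' : ((ξ / (ordProj[2] ξ * ordProj[3] ξ) : ℕ) : ℝ) ≤
        max C₀ 0 * (N : ℝ) ^ (ε / 4) * ((D.deg / (ordProj[2] D.deg * ordProj[3] D.deg) : ℕ) : ℝ) *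
          (T : ℝ) ^ 3 := by
      refine hcmp.trans ?_
      have h1 : (0 : ℝ) ≤ (N : ℝ) ^ (ε / 4) * ((D.deg / (ordProj[2] D.deg * ordProj[3] D.deg) : ℕ) : ℝ) *
          (T : ℝ) ^ 3 := by positivity
      calc C₀ * (N : ℝ) ^ (ε / 4) * ((D.deg / (ordProj[2] D.deg * ordProj[3] D.deg) : ℕ) : ℝ) * (T : ℝ) ^ 3
          = C₀ * ((N : ℝ) ^ (ε / 4) * ((D.deg / (ordProj[2] D.deg * ordProj[3] D.deg) : ℕ) : ℝ) *
              (T : ℝ) ^ 3) := by ring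
        _ ≤ max C₀ 0 * ((N : ℝ) ^ (ε / 4) * ((D.deg / (ordProj[2] D.deg * ordProj[3] D.deg) : ℕ) : ℝ) *
              (T : ℝ) ^ 3) := mul_le_mul_of_nonneg_right (le_max_left _ _) h1
        _ = _ := by ring
    calc ((ξ / (ordProj[2] ξ * ordProj[3] ξ) : ℕ) : ℝ) * (T : ℝ)
        ≤ (max C₀ 0 * (N : ℝ) ^ (ε / 4) * ((D.deg / (ordProj[2] D.deg * ordProj[3] D.deg) : ℕ) : ℝ) *
            (T : ℝ) ^ 3) * (T : ℝ) := mul_le_mul_of_nonneg_right hcmp' hT0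
      _ = max C₀ 0 * (N : ℝ) ^ (ε / 4) * ((D.deg / (ordProj[2] D.deg * ordProj[3] D.deg) : ℕ) : ℝ) *
            (T : ℝ) ^ (4 : ℕ) := by ring
      _ ≤ max C₀ 0 * (N : ℝ) ^ (ε / 4) * (max C₁ 0 * (N : ℝ) ^ (2 + ε / 4)) *
            (max C₂ 0 * (N : ℝ) ^ (ε / 8)) ^ (4 : ℕ) := by
          gcongr
      _ = max C₀ 0 * max C₁ 0 * max C₂ 0 ^ 4 *
            ((N : ℝ) ^ (ε / 4) * (N : ℝ) ^ (2 + ε / 4) * ((N : ℝ) ^ (ε / 8)) ^ (4 : ℕ)) := by ring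
      _ = max C₀ 0 * max C₁ 0 * max C₂ 0 ^ 4 * (N : ℝ) ^ (2 + ε) := by rw [hsplit]

/-- **`FreyDegreeBound ⟹ B♭` modulo ONE named fact** — Takahashi 2001 Thm. 2.3 at `q ∥ N`
(`takahashi2001_thm_2_3_of_coprime`) — plus the r9 ROUTE ITEMS `MazurKenkuBound` (stmt-ABC-15125, = the Mazur–Kenku
degree transport `PastenShimura2024_minimalDegree_le_163_mul`), `IsogenyValuationTransport` (stmt-ABC-18928, = Pasten
2024 Lemma 6.8; both identifications are `Iff.rfl`: `mazurKenkuBound_iff`, `isogenyValuationTransport_iff`) and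
`FreyModularity` (stmt-ABC-11340): child 1 at prime type (`xiDegreeComparison_prime_of_facts`, p137891, constant
`4·163²`), P6 from the thesis (`primeToSixDegreeBound_of_freyDegreeBound`) and the allowance from the weak rung
(`allTamExp_of_polyFreyDegree ∘ polyFreyDegree_of_freyDegreeBound`, p160000), glued by `primeRung_of_subs_frey`.
Contrast: the `∀`-`N⁻` crux needs Takahashi's theorem for Shimura curves (`hTlev`/`hT2`) and Jacquet–Langlands data
instead (`steinbergCore_of_freyDegreeBound_of_takahashi`, p160000).  Trust base beyond route items: that single fact.
[cite: Takahashi2001, Thm. 2.3 (p. 79), remark p. 80] [cite: PastenShimura2024, §3 p. 13 and Lemma 6.8 (p. 22)] -/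
theorem primeRung_of_freyDegreeBound_of_items (hT : takahashi2001_thm_2_3_of_coprime)
    (hMK : MazurKenkuBound) (hIVT : IsogenyValuationTransport) (hMod : FreyModularity) (hX : FreyDegreeBound) :
    ∀ ε : ℝ, 0 < ε → ∃ C : ℝ, ∀ a b : ℤ, IsCoprime a b → a * b * (a + b) ≠ 0 → ∀ (N : ℕ) [NeZero N],
      (freyCurve a b).conductorNorm ℤ = N → ∀ q : ℕ, q.Prime → q ≠ 2 → q ∣ N →
      ((brandtXi (N / q) q (fun n => (freyCurve a b).LFunction n) /
          (ordProj[2] (brandtXi (N / q) q (fun n => (freyCurve a b).LFunction n)) *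
            ordProj[3] (brandtXi (N / q) q (fun n => (freyCurve a b).LFunction n))) : ℕ) : ℝ) *
        ((∏ p ∈ N.primeFactors, ((freyCurve a b).minimalDiscriminantNorm ℤ).factorization p : ℕ) : ℝ) ≤
        C * (N : ℝ) ^ (2 + ε) :=
  primeRung_of_subs_frey
    (xiDegreeComparison_prime_of_facts hT (mazurKenkuBound_iff.mp hMK) (isogenyValuationTransport_iff.mp hIVT) hMod)
    (primeToSixDegreeBound_of_freyDegreeBound hX)
    (allTamExp_of_polyFreyDegree (DefiniteXiPolyFreyDegree.polyFreyDegree_of_freyDegreeBound hX))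

/-! ## (5) The calibration of the recut crux, and the `∀`-`N⁻` surplus -/

/-- **THE CALIBRATION OF `B♭`.**  Modulo Takahashi 2001 Thm. 2.3 at `q ∥ N` (ONE named fact), the r9 route items
`MazurKenkuBound`, `IsogenyValuationTransport`, `FreyModularity`, and — for `⟹` only — the prime rung `A♭` of the
abc-free binder together with `DefiniteRTControlPrime` discharged from the same fact and items
(`definiteRTControlPrime_of_items`): **the prime rung of `SteinbergCore` is EQUIVALENT to the thesis
`FreyDegreeBound`**.  So the recut crux is exactly thesis-strength relative to the route's own bets, as the
`∀`-`N⁻` crux is (p160000) — but its calibration, and child 1 of its split, no longer cite Takahashi's theorem for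
Shimura curves.  Exponent `2` sharp (Masser 1990); `0 < ε` load-bearing (Disproof §D).
[cite: Takahashi2001, Thm. 2.3 (p. 79), remark p. 80] [cite: PastenShimura2024, §3 p. 13 and Lemma 6.8 (p. 22)] -/
theorem primeRung_iff_freyDegreeBound_of_items : Literature.NumberTheory.EllipticCurves.takahashi2001_thm_2_3_of_coprime → Summit.ABC.ABC.Theses.DefiniteXi.MazurKenkuBound → Summit.ABC.ABC.Theses.DefiniteXi.IsogenyValuationTransport → Summit.ABC.ABC.Theses.DefiniteXi.FreyModularity → (∀ ε : ℝ, 0 < ε → ∃ C : ℝ, ∀ a b : ℤ, IsCoprime a b → a * b * (a + b) ≠ 0 → ∀ (N : ℕ) [NeZero N], (Literature.NumberTheory.EllipticCurves.freyCurve a b).conductorNorm ℤ = N → ∀ q : ℕ, q.Prime → q ≠ 2 → q ∣ N → ((ordProj[2] (Literature.NumberTheory.Automorphic.brandtXi (N / q) q (fun n => (Literature.NumberTheory.EllipticCurves.freyCurve a b).LFunction n)) * ordProj[3] (Literature.NumberTheory.Automorphic.brandtXi (N / q) q (fun n => (Literature.NumberTheory.EllipticCurves.freyCurve a b).LFunction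 n)) : ℕ) : ℝ) ≤ C * (N : ℝ) ^ ε * ((∏ p ∈ N.primeFactors \ {q}, ((Literature.NumberTheory.EllipticCurves.freyCurve a b).minimalDiscriminantNorm ℤ).factorization p : ℕ) : ℝ)) → ((∀ ε : ℝ, 0 < ε → ∃ C : ℝ, ∀ a b : ℤ, IsCoprime a b → a * b * (a + b) ≠ 0 → ∀ (N : ℕ) [NeZero N], (Literature.NumberTheory.EllipticCurves.freyCurve a b).conductorNorm ℤ = N → ∀ q : ℕ, q.Prime → q ≠ 2 → q ∣ N → ((Literature.NumberTheory.Automorphic.brandtXi (N / q) q (fun n => (Literature.NumberTheory.EllipticCurves.freyCurve a b).LFunction n) / (ordProj[2] (Literature.NumberTheory.Automorphic.brandtXi (N / q) q (fun n => (Literature.NumberTheory.EllipticCurves.freyCurve a b).LFunction n)) * ordProj[3] (Literature.NumberTheory.Automorphic.brandtXi (N / q) q (fun n => (Literature.NumberTheory.EllipticCurves.freyCurve a b).LFunction n))) : ℕ) : ℝ) * ((∏ p ∈ N.primeFactors, ((Literature.NumberTheory.EllipticCurves.freyCurve a b).minimalDiscriminantNorm ℤ).factorization p : ℕ) : ℝ)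 ≤ C * (N : ℝ) ^ (2 + ε)) ↔ Summit.ABC.ABC.Theses.DefiniteXi.FreyDegreeBound) :=
  fun hT hMK hIVT hMod hA =>
    ⟨fun hB => freyDegreeBound_of_primeRungs hA hB (definiteRTControlPrime_of_items hT hMK hIVT) hMod,
      primeRung_of_freyDegreeBound_of_items hT hMK hIVT hMod⟩

end Summit.ABC.ABC.Theorems.SteinbergCorePrimeRung

end
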